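import Mathlib
import Literature.Analysis.FluidPDE.GaussianVortexPlanar
import Literature.Analysis.FluidPDE.GaussianVortexPlanarProofs
import Literature.Analysis.FluidPDE.GaussianVortexFormDomainPoincare
import Summits.AnomalousDissipation.AnomalousDissipation.Theorems.MarginalStabilityChainStretchedVortexRowsStubCoreRotationLocalSkew
import HarnessLib

/-!
# The radial weights `Ω⁻¹`, `V = G/(2Ω)` and Gaussian moments (stub `stub_cellSolvability`,
# reduction step 3)

Helper file for the stub `stub_cellSolvability` of the line `braid-closed-large-circulation-gluing`
(crux stmt-AnomalousDissipation-3009, `MarginalStabilityChain.StretchedVortexRows`). In the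
reduction `stub_cellSolvability_of_streamSolvability` the cell solution is
`w = Ω⁻¹ ∂_θ⁻¹ g − V Ψ` with the two RADIAL WEIGHTS of the Gaussian vortex,
`Ω⁻¹(ξ) = 8π/φ(|ξ|²/4)` (inverse angular velocity, `φ = burgersPhi`, `Ω⁻¹ = 2π|ξ|²/(1 − e^{−|ξ|²/4})`)
and `V(ξ) = G/(2Ω) = 4πG(ξ)/φ(|ξ|²/4) = (|ξ|²/4)/(e^{|ξ|²/4} − 1)` (the potential of the stream
equation `ΔΨ + VΨ = F`). This file proves what the exponent count of the stub needs, packaged in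
the registered sub-goal `stub_cellSolvability_radialWeights`:

* `φ(s) ≥ 1/(1+s)` and `|φ′(s)| ≤ φ(s)²` for `s > 0` (from `1 + s ≤ eˢ`, `1 − s ≤ e^{−s}`), whence
  `Ω⁻¹` and `V` are smooth and even with `|Ω⁻¹| + |∇Ω⁻¹| ≤ 12π(1+|ξ|)²` ("`1/Ω` costs two powers")
  and `|V| + |∇V| ≤ 8π(1+|ξ|)³ G`;
* the product rule in the form `|fg| + |∇(fg)| ≤ (|f| + |∇f|)(|g| + |∇g|)`;
* Gaussian moments: `(1+|ξ|)ⁿ G` is bounded for every `n` (`(1+r)ⁿ e^{−r²/8} ≤ 2ⁿ(2 + 8ⁿ n!)` from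
  `xⁿ/n! ≤ eˣ`) and integrable (the latter from the sibling file `…StubCoreRotationLocalSkew`).
-/

set_option linter.dupNamespace false

noncomputable section

open scoped BigOperators Topology RealInnerProductSpace ContDiff Nat
open Filter Set Function MeasureTheory WithLp

namespace Summit.AnomalousDissipation.AnomalousDissipation.Theorems.MarginalStabilityChainStretchedVortexRows

open Literature.Analysis.FluidPDE

/-! ### Two inequalities for `φ(s) = (1 − e^{−s})/s` -/

/-- Off the origin, `φ′(s) = (e^{−s}(1 + s) − 1)/s²` (private copy of
`…StubCoreInverseBurgersPhi.hasDerivAt_burgersPhi_of_ne_zero`). [folklore] -/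
private theorem hasDerivAt_burgersPhi_of_ne_zero' {t : ℝ} (ht : t ≠ 0) :
    HasDerivAt burgersPhi ((Real.exp (-t) * (1 + t) - 1) / t ^ 2) t := by
  have heq : burgersPhi =ᶠ[𝓝 t] fun s => (1 - Real.exp (-s)) / s := by
    filter_upwards [isOpen_ne.mem_nhds ht] with s hs
    exact burgersPhi_of_ne_zero hs
  have h1 : HasDerivAt (fun s : ℝ => 1 - Real.exp (-s)) (Real.exp (-t)) t := by
    have : HasDerivAt (fun s : ℝ => Real.exp (-s)) (-Real.exp (-t)) t := by
      simpa using ((hasDerivAt_id t).neg).exp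
    simpa using this.const_sub 1
  have h2 : HasDerivAt (fun s : ℝ => s) 1 t := hasDerivAt_id t
  have h := h1.div h2 ht
  refine (h.congr_of_eventuallyEq heq).congr_deriv ?_
  field_simp
  ring

/-- **`φ(s) ≥ 1/(1+s)` for `s ≥ 0`** (i.e. `1 + s ≤ eˢ`): the inverse angular velocity grows at
most quadratically, `Ω⁻¹ = 8π/φ(|ξ|²/4) ≤ 8π(1 + |ξ|²/4)`. [folklore] -/
theorem inv_one_add_le_burgersPhi {s : ℝ} (hs : 0 ≤ s) : (1 + s)⁻¹ ≤ burgersPhi s := by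
  rcases hs.eq_or_lt with rfl | hs'
  · simp
  · rw [burgersPhi_of_ne_zero hs'.ne', inv_eq_one_div, div_le_div_iff₀ (by linarith) hs']
    have h1 : Real.exp (-s) * (1 + s) ≤ 1 := by
      have ha : 1 + s ≤ Real.exp s := by linarith [Real.add_one_le_exp s]
      have hb : Real.exp (-s) * Real.exp s = 1 := by rw [← Real.exp_add]; simp
      nlinarith [Real.exp_pos (-s)]
    nlinarith

/-- `1/φ(s) ≤ 1 + s` for `s ≥ 0`. [folklore] -/
theorem inv_burgersPhi_le {s : ℝ} (hs : 0 ≤ s) : (burgersPhi s)⁻¹ ≤ 1 + s := by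
  have h := inv_one_add_le_burgersPhi hs
  have hpos : 0 < (1 + s)⁻¹ := by positivity
  calc (burgersPhi s)⁻¹ ≤ ((1 + s)⁻¹)⁻¹ := inv_anti₀ hpos h
    _ = 1 + s := inv_inv _

/-- **`|φ′(s)| ≤ φ(s)²` for `s > 0`** (equivalently `1 − (1+s)e^{−s} ≤ (1 − e^{−s})²`, i.e.
`1 − s ≤ e^{−s}`): the gradient of `Ω⁻¹ = 8π/φ(|ξ|²/4)` is at most `4π|ξ|`. [folklore] -/
theorem abs_deriv_burgersPhi_le_sq {s : ℝ} (hs : 0 < s) :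
    |deriv burgersPhi s| ≤ burgersPhi s ^ 2 := by
  rw [(hasDerivAt_burgersPhi_of_ne_zero' hs.ne').deriv, burgersPhi_of_ne_zero hs.ne', div_pow,
    abs_div, abs_of_pos (pow_pos hs 2), div_le_div_iff_of_pos_right (pow_pos hs 2)]
  have hu : Real.exp (-s) * (1 + s) ≤ 1 := by
    have ha : 1 + s ≤ Real.exp s := by linarith [Real.add_one_le_exp s]
    have hb : Real.exp (-s) * Real.exp s = 1 := by rw [← Real.exp_add]; simp
    nlinarith [Real.exp_pos (-s)]
  have hl : 1 - s ≤ Real.exp (-s) := by linarith [Real.add_one_le_exp (-s)]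
  rw [abs_of_nonpos (by linarith)]
  nlinarith [Real.exp_pos (-s)]

/-! ### The product rule for the weighted `C¹` size `|f| + |∇f|` -/

/-- **`|fg| + |∇(fg)| ≤ (|f| + |∇f|)(|g| + |∇g|)`** at every point of differentiability. [folklore] -/
theorem abs_mul_add_norm_gradient_mul_le {f g : EuclideanSpace ℝ (Fin 2) → ℝ}
    {ξ : EuclideanSpace ℝ (Fin 2)} (hf : DifferentiableAt ℝ f ξ) (hg : DifferentiableAt ℝ g ξ) :
    |f ξ * g ξ| + ‖gradient (fun η => f η * g η) ξ‖ ≤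
      (|f ξ| + ‖gradient f ξ‖) * (|g ξ| + ‖gradient g ξ‖) := by
  have hgrad : gradient (fun η => f η * g η) ξ = f ξ • gradient g ξ + g ξ • gradient f ξ := by
    simp only [gradient, fderiv_fun_mul hf hg, map_add, map_smul]
  rw [hgrad, abs_mul]
  have h1 : ‖f ξ • gradient g ξ + g ξ • gradient f ξ‖ ≤ |f ξ| * ‖gradient g ξ‖ + |g ξ| * ‖gradient f ξ‖ :=
    (norm_add_le _ _).trans (by rw [norm_smul, norm_smul, Real.norm_eq_abs, Real.norm_eq_abs])
  nlinarith [abs_nonneg (f ξ), abs_nonneg (g ξ), norm_nonneg (gradient f ξ), norm_nonneg (gradient g ξ),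
    mul_nonneg (norm_nonneg (gradient f ξ)) (norm_nonneg (gradient g ξ))]

/-! ### The inverse angular velocity `Ω⁻¹ = 8π/φ(|ξ|²/4)` -/

/-- `Ω⁻¹` is smooth (`φ > 0` is smooth). [folklore] -/
theorem contDiff_invAngularVelocity {n : WithTop ℕ∞} :
    ContDiff ℝ n fun ξ : EuclideanSpace ℝ (Fin 2) => 8 * Real.pi / burgersPhi (‖ξ‖ ^ 2 / 4) :=
  contDiff_const.div (contDiff_burgersPhi.comp ((contDiff_norm_sq ℝ).div_const _))
    fun _ => (burgersPhi_pos _).ne'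

/-- `x ↦ |x|²/4` has derivative `v ↦ ⟪x, v⟫/2`. [folklore] -/
theorem hasFDerivAt_norm_sq_div_four (x : EuclideanSpace ℝ (Fin 2)) :
    HasFDerivAt (fun ξ : EuclideanSpace ℝ (Fin 2) => ‖ξ‖ ^ 2 / 4) ((1 / 2 : ℝ) • innerSL ℝ x) x := by
  have h1 := (hasStrictFDerivAt_norm_sq x).hasFDerivAt
  have h2 : HasDerivAt (fun t : ℝ => t / 4) (1 / 4) (‖x‖ ^ 2) := by
    simpa using (hasDerivAt_id (‖x‖ ^ 2)).div_const 4
  have h := h2.comp_hasFDerivAt x h1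
  refine h.congr_fderiv ?_
  ext v
  simp [two_smul]
  ring

/-- The norm of that derivative: `‖v ↦ ⟪x, v⟫/2‖ = |x|/2`. [folklore] -/
theorem norm_fderiv_norm_sq_div_four (x : EuclideanSpace ℝ (Fin 2)) :
    ‖(1 / 2 : ℝ) • innerSL ℝ x‖ = ‖x‖ / 2 := by
  rw [norm_smul, innerSL_apply_norm, Real.norm_eq_abs, abs_of_pos (by norm_num : (0 : ℝ) < 1 / 2)]
  ring

/-- **`|∇Ω⁻¹(ξ)| ≤ 4π|ξ|`.** [folklore] -/
theorem norm_gradient_invAngularVelocity_le (ξ : EuclideanSpace ℝ (Fin 2)) :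
    ‖gradient (fun ξ : EuclideanSpace ℝ (Fin 2) => 8 * Real.pi / burgersPhi (‖ξ‖ ^ 2 / 4)) ξ‖ ≤
      4 * Real.pi * ‖ξ‖ := by
  by_cases hξ : ξ = 0
  · -- at the origin the gradient of the even function `Ω⁻¹` vanishes
    subst hξ
    have heven : ∀ y : EuclideanSpace ℝ (Fin 2), (fun ξ : EuclideanSpace ℝ (Fin 2) =>
        8 * Real.pi / burgersPhi (‖ξ‖ ^ 2 / 4)) (-y) =
        (fun ξ : EuclideanSpace ℝ (Fin 2) => 8 * Real.pi / burgersPhi (‖ξ‖ ^ 2 / 4)) y :=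
      fun y => by simp [norm_neg]
    have h := fderiv_comp_smul (f := fun ξ : EuclideanSpace ℝ (Fin 2) =>
      8 * Real.pi / burgersPhi (‖ξ‖ ^ 2 / 4)) (x := (0 : EuclideanSpace ℝ (Fin 2))) (-1 : ℝ)
    have hfun : (fun y : EuclideanSpace ℝ (Fin 2) => (fun ξ : EuclideanSpace ℝ (Fin 2) =>
        8 * Real.pi / burgersPhi (‖ξ‖ ^ 2 / 4)) ((-1 : ℝ) • y)) =
        fun ξ : EuclideanSpace ℝ (Fin 2) => 8 * Real.pi / burgersPhi (‖ξ‖ ^ 2 / 4) :=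
      funext fun y => by simp [norm_neg]
    rw [hfun, smul_zero, neg_one_smul] at h
    have h0 : fderiv ℝ (fun ξ : EuclideanSpace ℝ (Fin 2) => 8 * Real.pi / burgersPhi (‖ξ‖ ^ 2 / 4)) 0 = 0 := by
      have h2 : (2 : ℝ) • fderiv ℝ (fun ξ : EuclideanSpace ℝ (Fin 2) =>
          8 * Real.pi / burgersPhi (‖ξ‖ ^ 2 / 4)) 0 = 0 := by
        rw [two_smul]; nth_rw 1 [h]; exact neg_add_cancel _
      exact (smul_eq_zero.1 h2).resolve_left two_ne_zero
    simp [gradient, h0]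
  · have hs : 0 < ‖ξ‖ ^ 2 / 4 := by positivity
    set d : ℝ := (Real.exp (-(‖ξ‖ ^ 2 / 4)) * (1 + ‖ξ‖ ^ 2 / 4) - 1) / (‖ξ‖ ^ 2 / 4) ^ 2 with hd
    have hφ : HasDerivAt burgersPhi d (‖ξ‖ ^ 2 / 4) := hasDerivAt_burgersPhi_of_ne_zero' hs.ne'
    have hne : burgersPhi (‖ξ‖ ^ 2 / 4) ≠ 0 := (burgersPhi_pos _).ne'
    have hq : HasDerivAt (fun t : ℝ => 8 * Real.pi * (burgersPhi t)⁻¹)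
        (8 * Real.pi * (-d / burgersPhi (‖ξ‖ ^ 2 / 4) ^ 2)) (‖ξ‖ ^ 2 / 4) :=
      (hφ.inv hne).const_mul _
    have hcomp := hq.comp_hasFDerivAt ξ (hasFDerivAt_norm_sq_div_four ξ)
    have hfun : (fun ξ : EuclideanSpace ℝ (Fin 2) => 8 * Real.pi / burgersPhi (‖ξ‖ ^ 2 / 4)) =
        (fun t : ℝ => 8 * Real.pi * (burgersPhi t)⁻¹) ∘ fun ξ : EuclideanSpace ℝ (Fin 2) => ‖ξ‖ ^ 2 / 4 :=
      funext fun ξ => by simp [div_eq_mul_inv]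
    rw [norm_gradient_eq_norm_fderiv_fin_two, hfun, hcomp.fderiv, norm_smul,
      norm_fderiv_norm_sq_div_four, Real.norm_eq_abs]
    have hdd : |d| ≤ burgersPhi (‖ξ‖ ^ 2 / 4) ^ 2 := by
      have := abs_deriv_burgersPhi_le_sq hs
      rwa [hφ.deriv] at this
    have hφ2 : 0 < burgersPhi (‖ξ‖ ^ 2 / 4) ^ 2 := pow_pos (burgersPhi_pos _) 2
    have hratio : |8 * Real.pi * (-d / burgersPhi (‖ξ‖ ^ 2 / 4) ^ 2)| ≤ 8 * Real.pi := by
      rw [abs_mul, abs_of_pos (by positivity : (0 : ℝ) < 8 * Real.pi), abs_div, abs_neg,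
        abs_of_pos hφ2]
      have : |d| / burgersPhi (‖ξ‖ ^ 2 / 4) ^ 2 ≤ 1 := by
        rw [div_le_one hφ2]; exact hdd
      nlinarith [Real.pi_pos]
    calc |8 * Real.pi * (-d / burgersPhi (‖ξ‖ ^ 2 / 4) ^ 2)| * (‖ξ‖ / 2)
        ≤ 8 * Real.pi * (‖ξ‖ / 2) := by gcongr
      _ = 4 * Real.pi * ‖ξ‖ := by ring

/-- **Size of `Ω⁻¹`**: `|Ω⁻¹| + |∇Ω⁻¹| ≤ 12π(1+|ξ|)²`. [folklore] -/
theorem invAngularVelocity_bound (ξ : EuclideanSpace ℝ (Fin 2)) :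
    |8 * Real.pi / burgersPhi (‖ξ‖ ^ 2 / 4)| +
        ‖gradient (fun ξ : EuclideanSpace ℝ (Fin 2) => 8 * Real.pi / burgersPhi (‖ξ‖ ^ 2 / 4)) ξ‖ ≤
      12 * Real.pi * (1 + ‖ξ‖) ^ 2 := by
  have hr := norm_nonneg ξ
  have hval : |8 * Real.pi / burgersPhi (‖ξ‖ ^ 2 / 4)| ≤ 8 * Real.pi * (1 + ‖ξ‖ ^ 2 / 4) := by
    rw [abs_of_pos (div_pos (by positivity) (burgersPhi_pos _)), div_eq_mul_inv]
    gcongr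
    exact inv_burgersPhi_le (by positivity)
  have hgrad := norm_gradient_invAngularVelocity_le ξ
  nlinarith [Real.pi_pos, sq_nonneg ‖ξ‖]

/-! ### The potential `V = G/(2Ω) = 4πG/φ(|ξ|²/4)` -/

/-- `V` is smooth. [folklore] -/
theorem contDiff_cellPotential {n : WithTop ℕ∞} :
    ContDiff ℝ n fun ξ : EuclideanSpace ℝ (Fin 2) =>
      4 * Real.pi * gaussVortexProfile ξ / burgersPhi (‖ξ‖ ^ 2 / 4) :=
  (contDiff_const.mul contDiff_gaussVortexProfile).div
    (contDiff_burgersPhi.comp ((contDiff_norm_sq ℝ).div_const _)) fun _ => (burgersPhi_pos _).ne'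

/-- Size of `G/2`: `|G/2| + |∇(G/2)| ≤ (1 + |ξ|) G / 2`. [folklore] -/
theorem half_gaussVortexProfile_bound (ξ : EuclideanSpace ℝ (Fin 2)) :
    |gaussVortexProfile ξ / 2| + ‖gradient (fun η : EuclideanSpace ℝ (Fin 2) => gaussVortexProfile η / 2) ξ‖ ≤
      (1 + ‖ξ‖) * gaussVortexProfile ξ / 2 := by
  have hG := gaussVortexProfile_pos ξ
  have hd : DifferentiableAt ℝ gaussVortexProfile ξ :=
    (contDiff_gaussVortexProfile (n := 1)).differentiable (by simp) ξ
  have hgrad : ‖gradient (fun η : EuclideanSpace ℝ (Fin 2) => gaussVortexProfile η / 2) ξ‖ ≤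
      ‖ξ‖ / 2 * gaussVortexProfile ξ / 2 := by
    rw [norm_gradient_eq_norm_fderiv_fin_two]
    have h2 : fderiv ℝ (fun η : EuclideanSpace ℝ (Fin 2) => gaussVortexProfile η / 2) ξ =
        (2 : ℝ)⁻¹ • fderiv ℝ gaussVortexProfile ξ := by
      have := fderiv_mul_const hd (2 : ℝ)⁻¹
      simp only [div_eq_mul_inv]
      rw [this]
    rw [h2, norm_smul, Real.norm_eq_abs, abs_of_pos (by norm_num : (0 : ℝ) < 2⁻¹)]
    have h3 : ‖fderiv ℝ gaussVortexProfile ξ‖ ≤ ‖ξ‖ / 2 * gaussVortexProfile ξ := by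
      refine ContinuousLinearMap.opNorm_le_bound _ (by positivity) fun v => ?_
      rw [fderiv_gaussVortexProfile_apply, Real.norm_eq_abs, abs_mul, abs_neg,
        abs_of_nonneg (by positivity : 0 ≤ gaussVortexProfile ξ / 2)]
      calc gaussVortexProfile ξ / 2 * |⟪ξ, v⟫| ≤ gaussVortexProfile ξ / 2 * (‖ξ‖ * ‖v‖) := by
            gcongr; exact abs_real_inner_le_norm ξ v
        _ = ‖ξ‖ / 2 * gaussVortexProfile ξ * ‖v‖ := by ring
    nlinarith
  rw [abs_of_pos (by positivity)]
  nlinarith [mul_nonneg (norm_nonneg ξ) hG.le]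

/-- **Size of `V`**: `|V| + |∇V| ≤ 8π(1+|ξ|)³ G` (`V = (G/2)·Ω⁻¹` and the product rule). [folklore] -/
theorem cellPotential_bound (ξ : EuclideanSpace ℝ (Fin 2)) :
    |4 * Real.pi * gaussVortexProfile ξ / burgersPhi (‖ξ‖ ^ 2 / 4)| +
        ‖gradient (fun ξ : EuclideanSpace ℝ (Fin 2) =>
          4 * Real.pi * gaussVortexProfile ξ / burgersPhi (‖ξ‖ ^ 2 / 4)) ξ‖ ≤
      8 * Real.pi * (1 + ‖ξ‖) ^ 3 * gaussVortexProfile ξ := by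
  have hfun : (fun ξ : EuclideanSpace ℝ (Fin 2) =>
      4 * Real.pi * gaussVortexProfile ξ / burgersPhi (‖ξ‖ ^ 2 / 4)) =
      fun ξ : EuclideanSpace ℝ (Fin 2) =>
        gaussVortexProfile ξ / 2 * (8 * Real.pi / burgersPhi (‖ξ‖ ^ 2 / 4)) :=
    funext fun ξ => by ring
  have hval : 4 * Real.pi * gaussVortexProfile ξ / burgersPhi (‖ξ‖ ^ 2 / 4) =
      gaussVortexProfile ξ / 2 * (8 * Real.pi / burgersPhi (‖ξ‖ ^ 2 / 4)) := by ring
  rw [hfun, hval]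
  have hG := gaussVortexProfile_pos ξ
  have hr := norm_nonneg ξ
  have hd1 : DifferentiableAt ℝ (fun η : EuclideanSpace ℝ (Fin 2) => gaussVortexProfile η / 2) ξ := by
    have := ((contDiff_gaussVortexProfile (n := 1)).differentiable (by simp) ξ).mul_const (2 : ℝ)⁻¹
    simpa only [div_eq_mul_inv] using this
  have hd2 : DifferentiableAt ℝ
      (fun η : EuclideanSpace ℝ (Fin 2) => 8 * Real.pi / burgersPhi (‖η‖ ^ 2 / 4)) ξ :=
    (contDiff_invAngularVelocity (n := 1)).differentiable (by simp) ξ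
  have h := abs_mul_add_norm_gradient_mul_le hd1 hd2
  have hA := half_gaussVortexProfile_bound ξ
  have hB := invAngularVelocity_bound ξ
  have hA0 : 0 ≤ |gaussVortexProfile ξ / 2| +
      ‖gradient (fun η : EuclideanSpace ℝ (Fin 2) => gaussVortexProfile η / 2) ξ‖ := by positivity
  have hB0 : 0 ≤ |8 * Real.pi / burgersPhi (‖ξ‖ ^ 2 / 4)| +
      ‖gradient (fun ξ : EuclideanSpace ℝ (Fin 2) => 8 * Real.pi / burgersPhi (‖ξ‖ ^ 2 / 4)) ξ‖ := by
    positivity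
  calc _ ≤ _ := h
    _ ≤ ((1 + ‖ξ‖) * gaussVortexProfile ξ / 2) * (12 * Real.pi * (1 + ‖ξ‖) ^ 2) :=
        mul_le_mul hA hB hB0 (by positivity)
    _ = 6 * Real.pi * (1 + ‖ξ‖) ^ 3 * gaussVortexProfile ξ := by ring
    _ ≤ 8 * Real.pi * (1 + ‖ξ‖) ^ 3 * gaussVortexProfile ξ := by
        gcongr
        norm_num

/-! ### Gaussian moments -/

/-- `(1 + r)ⁿ e^{−r²/8} ≤ 2ⁿ(2 + 8ⁿ n!)` for `r ≥ 0`. [folklore] -/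
theorem one_add_pow_mul_exp_neg_le (n : ℕ) {r : ℝ} (hr : 0 ≤ r) :
    (1 + r) ^ n * Real.exp (-(r ^ 2 / 8)) ≤ 2 ^ n * (2 + 8 ^ n * n !) := by
  have hexp1 : Real.exp (-(r ^ 2 / 8)) ≤ 1 := Real.exp_le_one_iff.2 (by nlinarith)
  have hexp0 : 0 < Real.exp (-(r ^ 2 / 8)) := Real.exp_pos _
  -- `(1 + r)ⁿ ≤ 2ⁿ (1 + rⁿ)`
  have h1 : (1 + r) ^ n ≤ 2 ^ n * (1 + r ^ n) := by
    rcases le_or_gt r 1 with h | h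
    · calc (1 + r) ^ n ≤ 2 ^ n := pow_le_pow_left₀ (by linarith) (by linarith) n
        _ ≤ 2 ^ n * (1 + r ^ n) := le_mul_of_one_le_right (by positivity) (by
            linarith [pow_nonneg hr n])
    · calc (1 + r) ^ n ≤ (2 * r) ^ n := pow_le_pow_left₀ (by linarith) (by linarith) n
        _ = 2 ^ n * r ^ n := mul_pow _ _ _
        _ ≤ 2 ^ n * (1 + r ^ n) := by gcongr; linarith
  -- `rⁿ ≤ 1 + r²ⁿ`
  have h2 : r ^ n ≤ 1 + r ^ (2 * n) := by
    rcases le_or_gt r 1 with h | h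
    · linarith [pow_le_one₀ hr h (n := n), pow_nonneg hr (2 * n)]
    · linarith [pow_le_pow_right₀ h.le (show n ≤ 2 * n by omega)]
  -- `r²ⁿ e^{−r²/8} ≤ 8ⁿ n!`
  have h3 : r ^ (2 * n) * Real.exp (-(r ^ 2 / 8)) ≤ 8 ^ n * n ! := by
    have h := Real.pow_div_factorial_le_exp (r ^ 2 / 8) (by positivity) n
    rw [div_le_iff₀ (by positivity)] at h
    have h' : (r ^ 2 / 8) ^ n ≤ ↑n ! * Real.exp (r ^ 2 / 8) := by rwa [mul_comm] at h
    have hmul : r ^ (2 * n) = 8 ^ n * (r ^ 2 / 8) ^ n := by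
      rw [div_pow, pow_mul, mul_div_cancel₀ _ (pow_ne_zero n (by norm_num : (8 : ℝ) ≠ 0))]
    rw [hmul, Real.exp_neg]
    have hfac : (0 : ℝ) < n ! := by positivity
    calc 8 ^ n * (r ^ 2 / 8) ^ n * (Real.exp (r ^ 2 / 8))⁻¹
        ≤ 8 ^ n * (↑n ! * Real.exp (r ^ 2 / 8)) * (Real.exp (r ^ 2 / 8))⁻¹ := by gcongr
      _ = 8 ^ n * n ! := by field_simp
  calc (1 + r) ^ n * Real.exp (-(r ^ 2 / 8))
      ≤ 2 ^ n * (1 + r ^ n) * Real.exp (-(r ^ 2 / 8)) := by gcongr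
    _ ≤ 2 ^ n * (1 + (1 + r ^ (2 * n))) * Real.exp (-(r ^ 2 / 8)) := by gcongr
    _ = 2 ^ n * (2 * Real.exp (-(r ^ 2 / 8)) + r ^ (2 * n) * Real.exp (-(r ^ 2 / 8))) := by ring
    _ ≤ 2 ^ n * (2 * 1 + 8 ^ n * n !) := by gcongr
    _ = 2 ^ n * (2 + 8 ^ n * n !) := by ring

/-- `G = (4π)⁻¹ e^{−|ξ|²/8} e^{−|ξ|²/8}`. [folklore] -/
theorem gaussVortexProfile_eq_mul_exp (ξ : EuclideanSpace ℝ (Fin 2)) :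
    gaussVortexProfile ξ = (4 * Real.pi)⁻¹ * Real.exp (-(‖ξ‖ ^ 2 / 8)) * Real.exp (-(‖ξ‖ ^ 2 / 8)) := by
  rw [gaussVortexProfile, mul_assoc, ← Real.exp_add]
  congr 2
  ring

/-- **Gaussian moments are bounded**: `(1+|ξ|)ⁿ G(ξ) ≤ (4π)⁻¹ 2ⁿ(2 + 8ⁿ n!)`. [folklore] -/
theorem one_add_norm_pow_mul_gaussVortexProfile_le (n : ℕ) (ξ : EuclideanSpace ℝ (Fin 2)) :
    (1 + ‖ξ‖) ^ n * gaussVortexProfile ξ ≤ (4 * Real.pi)⁻¹ * (2 ^ n * (2 + 8 ^ n * n !)) := by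
  have h := one_add_pow_mul_exp_neg_le n (norm_nonneg ξ)
  have hexp1 : Real.exp (-(‖ξ‖ ^ 2 / 8)) ≤ 1 := Real.exp_le_one_iff.2 (by nlinarith [norm_nonneg ξ])
  rw [gaussVortexProfile_eq_mul_exp]
  calc (1 + ‖ξ‖) ^ n * ((4 * Real.pi)⁻¹ * Real.exp (-(‖ξ‖ ^ 2 / 8)) * Real.exp (-(‖ξ‖ ^ 2 / 8)))
      = (4 * Real.pi)⁻¹ * ((1 + ‖ξ‖) ^ n * Real.exp (-(‖ξ‖ ^ 2 / 8))) * Real.exp (-(‖ξ‖ ^ 2 / 8)) := by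
        ring
    _ ≤ (4 * Real.pi)⁻¹ * (2 ^ n * (2 + 8 ^ n * n !)) * 1 := by gcongr
    _ = _ := mul_one _

/-! ### The registered package -/

/-- **Radial weights of the cell problem** (registered on stmt-AnomalousDissipation-3009 as the
sub-goal `stub_cellSolvability_radialWeights`; step 3 of the reduction
`stub_cellSolvability_of_streamSolvability`). `Ω⁻¹ = 8π/φ(|ξ|²/4)` and `V = 4πG/φ(|ξ|²/4)` are
smooth with `|Ω⁻¹| + |∇Ω⁻¹| ≤ 12π(1+|ξ|)²`, `|V| + |∇V| ≤ 8π(1+|ξ|)³G`, and the Gaussian moments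
`(1+|ξ|)ⁿ G` are integrable and bounded for every `n`. [folklore] -/
theorem stub_cellSolvability_radialWeights :
    ContDiff ℝ ∞ (fun ξ : EuclideanSpace ℝ (Fin 2) => 8 * Real.pi / burgersPhi (‖ξ‖ ^ 2 / 4)) ∧
    ContDiff ℝ ∞ (fun ξ : EuclideanSpace ℝ (Fin 2) =>
      4 * Real.pi * gaussVortexProfile ξ / burgersPhi (‖ξ‖ ^ 2 / 4)) ∧
    (∀ ξ : EuclideanSpace ℝ (Fin 2), |8 * Real.pi / burgersPhi (‖ξ‖ ^ 2 / 4)| +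
        ‖gradient (fun ξ : EuclideanSpace ℝ (Fin 2) => 8 * Real.pi / burgersPhi (‖ξ‖ ^ 2 / 4)) ξ‖ ≤
      12 * Real.pi * (1 + ‖ξ‖) ^ 2) ∧
    (∀ ξ : EuclideanSpace ℝ (Fin 2), |4 * Real.pi * gaussVortexProfile ξ / burgersPhi (‖ξ‖ ^ 2 / 4)| +
        ‖gradient (fun ξ : EuclideanSpace ℝ (Fin 2) =>
          4 * Real.pi * gaussVortexProfile ξ / burgersPhi (‖ξ‖ ^ 2 / 4)) ξ‖ ≤
      8 * Real.pi * (1 + ‖ξ‖) ^ 3 * gaussVortexProfile ξ) ∧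
    (∀ n : ℕ, (Integrable fun ξ : EuclideanSpace ℝ (Fin 2) => (1 + ‖ξ‖) ^ n * gaussVortexProfile ξ) ∧
      ∃ M : ℝ, ∀ ξ : EuclideanSpace ℝ (Fin 2), (1 + ‖ξ‖) ^ n * gaussVortexProfile ξ ≤ M) :=
  ⟨contDiff_invAngularVelocity, contDiff_cellPotential, invAngularVelocity_bound, cellPotential_bound,
    fun n => ⟨integrable_one_add_norm_pow_mul_gaussVortexProfile n,
      ⟨_, one_add_norm_pow_mul_gaussVortexProfile_le n⟩⟩⟩

end Summit.AnomalousDissipation.AnomalousDissipation.Theorems.MarginalStabilityChainStretchedVortexRows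

end
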